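import Summits.Ventures.Crystal3D.Theorems.StickyWulffConstantGenericWallFloorSampleDeficitOffset
import Summits.Ventures.Crystal3D.Theorems.StickyWulffConstantGenericWallFloorWallLedgerGDefs
import HarnessLib

/-!
# Registered stub `stub_affineSampleDeficit` of line `WallLedgerG` (crux `GenericWallFloor`,
# stmt-Ventures-19480), BY NAME: the clamped slab sample of a MOVED fcc lattice counts its two flat faces

HONEST FRAMING. Part of the venture `Summits/Ventures/Crystal3D` (cell `crystal3d-full`), route
`route-Ventures-StickyWulffConstant`.  The planner's REGISTERED skeleton `WallLedgerG`
(`HOME/cf-p1/route/lines/wall/WallLedgerG.lean`, cf-p1 gen 16; vocabulary landed as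
`…GenericWallFloorWallLedgerGDefs.lean`) splits the clamped-cylinder wall cell as
`D(X) = D(P₁) + D(P₂) + D(Y) − cross − cross`; this file proves the first of its two stubs,

  `stub_affineSampleDeficit : AffineSampleDeficit` —

for every rigid motion `p ↦ A p + t`, every thickness `R ≥ 1`, with `C = 60 √2 π` (uniform in `A, t`, the
window and the normal): the sample `P = (A·Λ₀ + t) ∩ {a ≤ p₂ ≤ b, p₀² + p₁² ≤ ρ²}` (`b − a = R ≤ ρ`) has
`D(P) ≥ 2 φ(A⁻¹ e₃) π ρ² − C ρ`.

Proof: pull `P` back through the motion.  With `ν = A⁻¹ e₃`, `s = A⁻¹ t` one has `A q + t = A (q + s)`,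
so `(A q + t)₂ = ⟪q + s, ν⟫` and `(A q + t)₀² + (A q + t)₁² = ‖q + s‖² − ⟪q + s, ν⟫²`; the pulled-back
sample is exactly the offset/window sample of `Λ₀` bounded by `sampleDeficit_offset_window`
(`…GenericWallFloorSampleDeficitOffset`), and `contactDeficiency` is invariant under isometries
(`contactDeficiency_image_of_isometry`).

WHAT THIS IS NOT: the crux stub `stub_twoSlabAdhesion` (the adhesion excess of the filling) is untouched;
rung F-C1 not moved.
-/

noncomputable section

namespace Summit.Ventures.Crystal3D.Theorems

open Summit.Ventures.Crystal3D Finset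
open Summit.Ventures.Crystal3D.Cruxes.GenericWallFloor.WallLedgerG
open Literature.MathematicalPhysics.StatisticalMechanics (fccStacking orderedContacts contactDeficiency)
open scoped InnerProductSpace

/-- The number of ordered contact pairs is invariant under an isometry of `ℝ³`. -/
theorem orderedContacts_image_of_isometry {g : EuclideanSpace ℝ (Fin 3) → EuclideanSpace ℝ (Fin 3)}
    (hg : Isometry g) (X : Finset (EuclideanSpace ℝ (Fin 3))) :
    orderedContacts (X.image g) = orderedContacts X := by
  classical
  unfold orderedContacts
  rw [← prodMap_image_product, filter_image]
  have hinj : Function.Injective (Prod.map g g) := by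
    intro p q h
    simp only [Prod.map, Prod.mk.injEq] at h
    exact Prod.ext (hg.injective h.1) (hg.injective h.2)
  rw [card_image_of_injective _ hinj]
  congr 1
  refine filter_congr fun p _ => ?_
  simp only [Prod.map]
  rw [hg.dist_eq]

/-- **Contact deficiency is invariant under isometries** (a rigid motion carries a unit configuration to a
unit configuration with the same contacts). -/
theorem contactDeficiency_image_of_isometry {g : EuclideanSpace ℝ (Fin 3) → EuclideanSpace ℝ (Fin 3)}
    (hg : Isometry g) (X : Finset (EuclideanSpace ℝ (Fin 3))) :
    contactDeficiency (X.image g) = contactDeficiency X := by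
  classical
  unfold contactDeficiency
  rw [orderedContacts_image_of_isometry hg, card_image_of_injective _ hg.injective]

/-- `p₀² + p₁² = ‖p‖² − ⟪p, e₃⟫²` in `ℝ³`. -/
theorem sq_add_sq_eq_norm_sq_sub (p : EuclideanSpace ℝ (Fin 3)) :
    p 0 ^ 2 + p 1 ^ 2 = ‖p‖ ^ 2 - ⟪p, EuclideanSpace.single (2 : Fin 3) (1 : ℝ)⟫_ℝ ^ 2 := by
  rw [EuclideanSpace.real_norm_sq_eq, EuclideanSpace.inner_single_right, Fin.sum_univ_three]
  simp only [one_mul, conj_trivial]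
  ring

/-- **Registered stub `stub_affineSampleDeficit`** of line `WallLedgerG` (crux `GenericWallFloor`,
stmt-Ventures-19480), BY NAME: for every rigid motion `p ↦ A p + t` and every `R ≥ 1` there is `C`
(`= 60 √2 π`) such that for every window `[a, b]` with `b − a = R` and every `ρ ≥ R`, the clamped slab
sample `P = (A·Λ₀ + t) ∩ {a ≤ p₂ ≤ b, p₀² + p₁² ≤ ρ²}` has `D(P) ≥ 2 φ(A⁻¹ e₃) π ρ² − C ρ`. -/
theorem stub_affineSampleDeficit : AffineSampleDeficit := by
  classical
  intro A t R hR
  obtain ⟨C, hC⟩ := sampleDeficit_offset_window R hR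
  refine ⟨C, ?_⟩
  intro a b hab ρ hρ P hP
  -- the pulled-back normal and offset
  set e₃ : EuclideanSpace ℝ (Fin 3) := EuclideanSpace.single (2 : Fin 3) (1 : ℝ) with he₃
  set ν : EuclideanSpace ℝ (Fin 3) := A.symm e₃ with hν
  set s : EuclideanSpace ℝ (Fin 3) := A.symm t with hs
  have he₃n : ‖e₃‖ = 1 := by
    rw [he₃, PiLp.norm_single, norm_one]
  have hνn : ‖ν‖ = 1 := by rw [hν, LinearIsometryEquiv.norm_map, he₃n]
  have hAν : A ν = e₃ := by rw [hν, LinearIsometryEquiv.apply_symm_apply]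
  have hAs : A s = t := by rw [hs, LinearIsometryEquiv.apply_symm_apply]
  -- the motion and its inverse
  set g : EuclideanSpace ℝ (Fin 3) → EuclideanSpace ℝ (Fin 3) := fun q => A q + t with hg
  set ginv : EuclideanSpace ℝ (Fin 3) → EuclideanSpace ℝ (Fin 3) := fun p => A.symm (p - t) with hginv
  have hg_ginv : ∀ p, g (ginv p) = p := by
    intro p; simp only [hg, hginv, LinearIsometryEquiv.apply_symm_apply]; abel
  have hginv_g : ∀ q, ginv (g q) = q := by
    intro q; simp only [hg, hginv, add_sub_cancel_right, LinearIsometryEquiv.symm_apply_apply]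
  have hginv_iso : Isometry ginv := by
    intro p q
    simp only [hginv, edist_dist, LinearIsometryEquiv.dist_map, dist_sub_right]
  have hgq : ∀ q, g q = A (q + s) := by
    intro q; simp only [hg, map_add, hAs]
  -- coordinates of `g q`
  have h2 : ∀ q, g q 2 = ⟪q + s, ν⟫_ℝ := by
    intro q
    have : g q 2 = ⟪g q, e₃⟫_ℝ := by
      rw [he₃, EuclideanSpace.inner_single_right]; simp
    rw [this, hgq, ← hAν, LinearIsometryEquiv.inner_map_map]
  have hlat : ∀ q, g q 0 ^ 2 + g q 1 ^ 2 = ‖q + s‖ ^ 2 - ⟪q + s, ν⟫_ℝ ^ 2 := by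
    intro q
    rw [sq_add_sq_eq_norm_sq_sub, ← he₃, hgq, LinearIsometryEquiv.norm_map, ← hAν,
      LinearIsometryEquiv.inner_map_map]
  -- the pulled-back sample
  set P' : Finset (EuclideanSpace ℝ (Fin 3)) := P.image ginv with hP'
  have hmemP' : ∀ q, q ∈ P' ↔ g q ∈ P := by
    intro q
    rw [hP', mem_image]
    constructor
    · rintro ⟨p, hp, rfl⟩
      rw [hg_ginv]; exact hp
    · intro hq
      exact ⟨g q, hq, hginv_g q⟩
  have hP'iff : ∀ q, q ∈ P' ↔ (q ∈ fccStacking 1 (Real.sqrt (2 / 3)) ∧ a ≤ ⟪q + s, ν⟫_ℝ ∧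
      ⟪q + s, ν⟫_ℝ ≤ a + R ∧ ‖q + s‖ ^ 2 - ⟪q + s, ν⟫_ℝ ^ 2 ≤ ρ ^ 2) := by
    intro q
    rw [hmemP', hP (g q), h2, hlat, ← hab, add_sub_cancel]
    have himg : g q ∈ (fun q => A q + t) '' fccStacking 1 (Real.sqrt (2 / 3)) ↔
        q ∈ fccStacking 1 (Real.sqrt (2 / 3)) := by
      constructor
      · rintro ⟨q', hq', hqq'⟩
        have : q' = q := by
          have h1 : ginv (g q') = ginv (g q) := congrArg ginv hqq'
          rwa [hginv_g, hginv_g] at h1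
        rw [← this]; exact hq'
      · intro hq
        exact ⟨q, hq, rfl⟩
    rw [himg]
  have hbound := hC ν hνn s a ρ hρ P' hP'iff
  have hDP : contactDeficiency P' = contactDeficiency P := by
    rw [hP', contactDeficiency_image_of_isometry hginv_iso]
  rw [hDP] at hbound
  exact hbound

end Summit.Ventures.Crystal3D.Theorems

end
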